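import Literature.MathematicalPhysics.KineticTheory.LorentzGasPathIntegral
import HarnessLib

/-!
# Volume of the tube around a virtual orbit: the cylinder bound
(trunk T-KINETIC; topic MathematicalPhysics/KineticTheory; proofs towards the core fact
`Literature.MathematicalPhysics.KineticTheory.gallavotti_lorentz_tendsto_dual` of `LorentzGasGallavotti`)

In Gallavotti's computation the probability that no scatterer obstructs the light particle's path
is the Poisson void probability of the tube around the path, `e^{-λ |T|}`, and the Boltzmann–Grad
asymptotics `λ |T_ε| → σ ν(v) t` (Golse 2012, proof of Thm. 2.1: `|T(t; c₁, …, c_j)| = 2rt + O(r²)`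
in `d = 2`; Spohn 1991 (8.133): `|T_ε| = const · ε^{d-1}`) comes from the volume of thin cylinders.
Only an *upper* bound on `|T_ε|` (a lower bound on the void probability) is needed for the liminf
form of the limit. This file proves:

* `Kinetic.volume_lineCylinder` (**from P4**): the volume of the finite cylinder of radius `ε`
  around the line `x + ℝv` with along-coordinate in `(a, b)` is *exactly*
  `ε^{d-1} (b - a) ν(v)/‖v‖²·‖v‖ = ε^{d-1} (b - a) ν(v)/‖v‖`, `ν = Kinetic.lorentzLossRate` (the
  entrance parametrisation `Kinetic.hardSphere_entranceParametrization`, named fact P4, applied to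
  the indicator of a slab) — this is where the constant `ν(v)` of the limiting loss frequency
  appears geometrically;
* `Kinetic.segmentTube_subset_lineCylinder`: the open `ε`-neighbourhood of a segment of duration
  `u` lies in the cylinder with along-coordinate in `(-ε, u‖v‖ + ε)`;
* `Kinetic.volume_virtualTube_le` (**the cylinder bound**): for path coordinates with positive
  durations summing to `≤ t`,
  `|virtualTube ε z t p| ≤ ε^{d-1} ν(v)/‖v‖ · (‖v‖ t + 2 (n + 1) ε) + |B̄(0, ε)|`
  (union bound over the `n + 1` segments and the closed end ball; speed is constant along the
  virtual orbit). Multiplied by the intensity `σ ε^{1-d}` this tends to `σ ν(v) t`.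

## References

* F. Golse, *Recent results on the periodic Lorentz gas*, Springer Basel (2011), §2, proof of
  Thm. 2.1 (arXiv:0906.0191).
* H. Spohn, *Large Scale Dynamics of Interacting Particles*, Springer (1991), (8.133).
-/

open MeasureTheory Metric Real Set Filter Topology
open scoped InnerProductSpace ENNReal

namespace Literature.MathematicalPhysics.KineticTheory

noncomputable section

universe u

variable {d : Type u} [Fintype d]

/-- **Volume of a finite cylinder around a line, from the entrance parametrisation.** For `v ≠ 0`,
`ε > 0` and `a ≤ b`, the set of points at distance `< ε` from the line `x + ℝv` whose
along-coordinate `⟪c - x, v⟫/‖v‖` lies in `(a, b)` has volume `ε^{d-1} ν(v) (b - a)/‖v‖`,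
`ν(v) = ∫ (v·ω)₊ dω` (P4 applied to the indicator of the slab: the time integral is the length
`(b - a)/‖v‖` of an interval, whatever `ω`). [folklore] -/
theorem volume_lineCylinder (hP4 : hardSphere_entranceParametrization.{u})
    (x v : EuclideanSpace ℝ d) (hv : v ≠ 0) {ε : ℝ} (hε : 0 < ε) {a b : ℝ} (hab : a ≤ b) :
    volume ({c : EuclideanSpace ℝ d | ∃ s : ℝ, dist c (x + s • v) < ε} ∩
      {c | ⟪c - x, v⟫_ℝ / ‖v‖ ∈ Ioo a b}) =
      ENNReal.ofReal (ε ^ (Fintype.card d - 1) * lorentzLossRate v * (b - a) / ‖v‖) := by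
  have hvn : 0 < ‖v‖ := norm_pos_iff.2 hv
  have hv2 : ‖v‖ ^ 2 ≠ 0 := pow_ne_zero 2 hvn.ne'
  -- the slab indicator
  set S : Set (EuclideanSpace ℝ d) := {c | ⟪c - x, v⟫_ℝ / ‖v‖ ∈ Ioo a b} with hS
  have hSm : MeasurableSet S :=
    measurableSet_Ioo.preimage (((continuous_id.sub continuous_const).inner continuous_const).div_const
      _).measurable
  have h := hP4 x v hv hε (S.indicator 1) ((measurable_one.indicator hSm))
  rw [finrank_euclideanSpace, lintegral_indicator hSm] at h
  simp only [Pi.one_apply, lintegral_one, Measure.restrict_apply MeasurableSet.univ, univ_inter,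
    Measure.restrict_apply hSm] at h
  rw [inter_comm] at h
  rw [← h]
  -- compute the left-hand side: for each `ω` the time integral is `(b - a)/‖v‖`
  have hinner : ∀ ω : sphere (0 : EuclideanSpace ℝ d) 1,
      ∫⁻ s : ℝ, S.indicator 1 (x + s • v + ε • (ω : EuclideanSpace ℝ d)) *
        ENNReal.ofReal (ε ^ (Fintype.card d - 1) * max ⟪v, (ω : EuclideanSpace ℝ d)⟫_ℝ 0) =
      ENNReal.ofReal ((b - a) / ‖v‖) *
        ENNReal.ofReal (ε ^ (Fintype.card d - 1) * max ⟪v, (ω : EuclideanSpace ℝ d)⟫_ℝ 0) := by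
    intro ω
    have hm : Measurable fun s : ℝ => S.indicator (1 : EuclideanSpace ℝ d → ℝ≥0∞)
        (x + s • v + ε • (ω : EuclideanSpace ℝ d)) :=
      (measurable_one.indicator hSm).comp
        ((measurable_const.add (measurable_id.smul measurable_const)).add measurable_const)
    rw [lintegral_mul_const _ hm]
    congr 1
    -- the set of times is an interval of length `(b - a)/‖v‖`
    set k : ℝ := ε * ⟪(ω : EuclideanSpace ℝ d), v⟫_ℝ / ‖v‖ with hk
    have hpre : ∀ s : ℝ, (x + s • v + ε • (ω : EuclideanSpace ℝ d)) ∈ S ↔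
        s ∈ Ioo ((a - k) / ‖v‖) ((b - k) / ‖v‖) := by
      intro s
      simp only [hS, mem_setOf_eq, mem_Ioo]
      have halong : ⟪x + s • v + ε • (ω : EuclideanSpace ℝ d) - x, v⟫_ℝ / ‖v‖ = s * ‖v‖ + k := by
        rw [show x + s • v + ε • (ω : EuclideanSpace ℝ d) - x = s • v + ε • (ω : EuclideanSpace ℝ d)
          by abel, inner_add_left, inner_smul_left, inner_smul_left, real_inner_self_eq_norm_sq, hk]
        simp only [RCLike.conj_to_real]
        field_simp
      rw [halong, lt_div_iff₀ hvn, div_lt_iff₀ hvn]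
      constructor <;> rintro ⟨h1, h2⟩ <;> constructor <;> linarith
    have hset : (fun s : ℝ => S.indicator (1 : EuclideanSpace ℝ d → ℝ≥0∞)
        (x + s • v + ε • (ω : EuclideanSpace ℝ d))) =
        (Ioo ((a - k) / ‖v‖) ((b - k) / ‖v‖)).indicator 1 := by
      funext s
      by_cases hs : x + s • v + ε • (ω : EuclideanSpace ℝ d) ∈ S
      · rw [indicator_of_mem hs, indicator_of_mem ((hpre s).1 hs)]; rfl
      · rw [indicator_of_notMem hs, indicator_of_notMem (fun h' => hs ((hpre s).2 h'))]
    rw [hset, lintegral_indicator measurableSet_Ioo]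
    simp only [Pi.one_apply, lintegral_one, Measure.restrict_apply MeasurableSet.univ, univ_inter,
      Real.volume_Ioo]
    congr 1
    field_simp
    ring
  simp_rw [hinner]
  -- the `ω`-integral: `∫ (v·ω)₊ dω = ν(v)`
  have hcst : ∀ ω : sphere (0 : EuclideanSpace ℝ d) 1,
      ENNReal.ofReal ((b - a) / ‖v‖) *
        ENNReal.ofReal (ε ^ (Fintype.card d - 1) * max ⟪v, (ω : EuclideanSpace ℝ d)⟫_ℝ 0) =
      ENNReal.ofReal ((b - a) / ‖v‖ * ε ^ (Fintype.card d - 1)) *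
        ENNReal.ofReal (max ⟪v, (ω : EuclideanSpace ℝ d)⟫_ℝ 0) := fun ω => by
    have hA : 0 ≤ (b - a) / ‖v‖ := div_nonneg (sub_nonneg.2 hab) hvn.le
    have hE : 0 ≤ ε ^ (Fintype.card d - 1) := by positivity
    rw [← ENNReal.ofReal_mul hA, ← ENNReal.ofReal_mul (mul_nonneg hA hE)]
    congr 1
    ring
  simp_rw [hcst]
  rw [lintegral_const_mul' _ _ ENNReal.ofReal_ne_top]
  have hν : ∫⁻ ω : sphere (0 : EuclideanSpace ℝ d) 1,
      ENNReal.ofReal (max ⟪v, (ω : EuclideanSpace ℝ d)⟫_ℝ 0) ∂KineticTheory.sphereMeasure =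
      ENNReal.ofReal (lorentzLossRate v) := by
    rw [lorentzLossRate, ofReal_integral_eq_lintegral_ofReal]
    · exact ((continuous_const.inner continuous_subtype_val).max continuous_const).integrable_of_hasCompactSupport
        (HasCompactSupport.of_compactSpace _)
    · exact Eventually.of_forall fun ω => le_max_right _ _
  rw [hν, ← ENNReal.ofReal_mul (by positivity)]
  congr 1
  field_simp

/-- **The `ε`-neighbourhood of a segment lies in a finite cylinder**: points within distance `< ε`
of `{x + τv : τ ∈ [0, u]}` are within `< ε` of the line and have along-coordinate in
`(-ε, u‖v‖ + ε)` (Cauchy–Schwarz). [folklore] -/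
theorem segmentTube_subset_lineCylinder (x v : EuclideanSpace ℝ d) (hv : v ≠ 0) (ε u : ℝ) :
    {c : EuclideanSpace ℝ d | ∃ τ ∈ Icc (0 : ℝ) u, dist c (x + τ • v) < ε} ⊆
      {c : EuclideanSpace ℝ d | ∃ s : ℝ, dist c (x + s • v) < ε} ∩
        {c | ⟪c - x, v⟫_ℝ / ‖v‖ ∈ Ioo (-ε) (u * ‖v‖ + ε)} := by
  rintro c ⟨τ, hτ, hdist⟩
  have hvn : 0 < ‖v‖ := norm_pos_iff.2 hv
  refine ⟨⟨τ, hdist⟩, ?_⟩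
  -- along-coordinate: `⟪c - x, v⟫/‖v‖ = τ‖v‖ + ⟪c - (x + τv), v⟫/‖v‖`
  have hdec : ⟪c - x, v⟫_ℝ / ‖v‖ = τ * ‖v‖ + ⟪c - (x + τ • v), v⟫_ℝ / ‖v‖ := by
    rw [show c - x = (c - (x + τ • v)) + τ • v by abel, inner_add_left, inner_smul_left,
      real_inner_self_eq_norm_sq]
    simp only [RCLike.conj_to_real]
    field_simp
    ring
  have hcs : |⟪c - (x + τ • v), v⟫_ℝ| / ‖v‖ < ε := by
    rw [div_lt_iff₀ hvn]
    calc |⟪c - (x + τ • v), v⟫_ℝ| ≤ ‖c - (x + τ • v)‖ * ‖v‖ := abs_real_inner_le_norm _ _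
      _ < ε * ‖v‖ := by
        rw [← dist_eq_norm]; exact mul_lt_mul_of_pos_right hdist hvn
  rw [mem_setOf_eq, hdec, mem_Ioo]
  have h1 := (abs_lt.1 (by rwa [abs_div, abs_of_pos hvn] : |⟪c - (x + τ • v), v⟫_ℝ / ‖v‖| < ε))
  constructor
  · nlinarith [hτ.1, h1.1]
  · nlinarith [hτ.2, h1.2]

/-- **The cylinder bound on the volume of the virtual tube.** Let P4 hold, `ε > 0`, `z = (x, v)`
with `v ≠ 0`, and let `p` have nonnegative durations summing to `≤ t`. Then
`|virtualTube ε z t p| ≤ ε^{d-1} ν(v)/‖v‖ · (‖v‖ t + 2 (n + 1) ε) + |B̄(x, ε)|`, `n = p.length`: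
the tube is contained in the union of the `ε`-neighbourhoods of the `n + 1` free-flight segments
(each inside a finite cylinder, `segmentTube_subset_lineCylinder`, of volume given by
`volume_lineCylinder`; the speed is constant along the orbit) and the closed end ball. Multiplied
by the Boltzmann–Grad intensity `σ ε^{1-d}` the bound tends to `σ ν(v) t` as `ε → 0`.
[cite: Golse2011, Thm. 2.1 (proof: |T(t;c₁,…,c_j)| = 2rt + O(r²))] -/
theorem volume_virtualTube_le (hP4 : hardSphere_entranceParametrization.{u}) {ε : ℝ} (hε : 0 < ε) :
    ∀ (p : List (ℝ × sphere (0 : EuclideanSpace ℝ d) 1)) (z : EuclideanSpace ℝ d × EuclideanSpace ℝ d),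
      z.2 ≠ 0 → (∀ q ∈ p, 0 ≤ q.1) → ∀ {t : ℝ}, (p.map Prod.fst).sum ≤ t →
      volume (virtualTube ε z t p) ≤
        ENNReal.ofReal (ε ^ (Fintype.card d - 1) * lorentzLossRate z.2 / ‖z.2‖ *
          (‖z.2‖ * t + 2 * (p.length + 1) * ε)) + volume (closedBall (0 : EuclideanSpace ℝ d) ε)
  | [], (x, v), hv, _, t, hsum => by
    simp only [List.map_nil, List.sum_nil] at hsum
    have hvn : 0 < ‖v‖ := norm_pos_iff.2 hv
    -- tube of the single segment plus the end ball
    have hsub : virtualTube ε (x, v) t [] ⊆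
        ({c : EuclideanSpace ℝ d | ∃ s : ℝ, dist c (x + s • v) < ε} ∩
          {c | ⟪c - x, v⟫_ℝ / ‖v‖ ∈ Ioo (-ε) (t * ‖v‖ + ε)}) ∪ closedBall (x + t • v) ε := by
      intro a ha
      rw [mem_virtualTube] at ha
      rcases ha with ⟨τ, hτ, hlt⟩ | hle
      · left
        exact segmentTube_subset_lineCylinder x v hv ε t ⟨τ, hτ, by simpa using hlt⟩
      · right
        simpa [mem_closedBall] using hle
    refine (measure_mono hsub).trans ((measure_union_le _ _).trans ?_)
    rw [volume_lineCylinder hP4 x v hv hε (by nlinarith [hε, hvn]), Measure.addHaar_closedBall_center]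
    gcongr
    · simp only [List.length_nil, CharP.cast_eq_zero, zero_add, mul_one]
      apply le_of_eq
      field_simp
      ring
  | (u, ω) :: p, (x, v), hv, hdur, t, hsum => by
    have hvn : 0 < ‖v‖ := norm_pos_iff.2 hv
    have hu : 0 ≤ u := hdur (u, ω) List.mem_cons_self
    have hdur' : ∀ q ∈ p, 0 ≤ q.1 := fun q hq => hdur q (List.mem_cons_of_mem _ hq)
    simp only [List.map_cons, List.sum_cons] at hsum
    have hsum0 : 0 ≤ (p.map Prod.fst).sum := List.sum_nonneg fun a ha => by
      obtain ⟨q, hq, rfl⟩ := List.mem_map.1 ha; exact hdur' q hq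
    set x₁ : EuclideanSpace ℝ d := x + u • v with hx₁
    set v₁ : EuclideanSpace ℝ d := v - (2 * ⟪v, (ω : EuclideanSpace ℝ d)⟫_ℝ) • (ω : EuclideanSpace ℝ d)
      with hv₁
    have hv₁n : ‖v₁‖ = ‖v‖ := Literature.Analysis.FunctionSpaces.norm_sub_two_mul_inner_smul v ω
    have hv₁0 : v₁ ≠ 0 := by rw [← norm_ne_zero_iff, hv₁n]; exact hvn.ne'
    -- tube ⊆ (first segment's neighbourhood) ∪ (tube of the tail)
    have hsub : virtualTube ε (x, v) t ((u, ω) :: p) ⊆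
        ({c : EuclideanSpace ℝ d | ∃ s : ℝ, dist c (x + s • v) < ε} ∩
          {c | ⟪c - x, v⟫_ℝ / ‖v‖ ∈ Ioo (-ε) (u * ‖v‖ + ε)}) ∪ virtualTube ε (x₁, v₁) (t - u) p := by
      intro a ha
      rw [mem_virtualTube] at ha
      rcases ha with ⟨τ, hτ, hlt⟩ | hle
      · rcases lt_or_ge τ u with hτu | huτ
        · left
          refine segmentTube_subset_lineCylinder x v hv ε u ⟨τ, ⟨hτ.1, hτu.le⟩, ?_⟩
          rwa [Literature.Analysis.FunctionSpaces.virtualState_cons_of_lt (x, v) ω p hτu] at hlt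
        · right
          rw [mem_virtualTube]
          left
          refine ⟨τ - u, ⟨sub_nonneg.2 huτ, by linarith [hτ.2]⟩, ?_⟩
          rwa [Literature.Analysis.FunctionSpaces.virtualState_cons_of_le (x, v) ω p huτ] at hlt
      · right
        rw [mem_virtualTube]
        right
        rwa [Literature.Analysis.FunctionSpaces.virtualState_cons_of_le (x, v) ω p (by linarith)] at hle
    have IH := volume_virtualTube_le hP4 hε p (x₁, v₁) hv₁0 hdur' (t := t - u) (by linarith)
    refine (measure_mono hsub).trans ((measure_union_le _ _).trans ?_)
    rw [volume_lineCylinder hP4 x v hv hε (by nlinarith [hε, hvn])]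
    calc ENNReal.ofReal (ε ^ (Fintype.card d - 1) * lorentzLossRate v * (u * ‖v‖ + ε - -ε) / ‖v‖) +
          volume (virtualTube ε (x₁, v₁) (t - u) p)
        ≤ ENNReal.ofReal (ε ^ (Fintype.card d - 1) * lorentzLossRate v * (u * ‖v‖ + ε - -ε) / ‖v‖) +
          (ENNReal.ofReal (ε ^ (Fintype.card d - 1) * lorentzLossRate v₁ / ‖v₁‖ *
            (‖v₁‖ * (t - u) + 2 * (p.length + 1) * ε)) + volume (closedBall (0 : EuclideanSpace ℝ d) ε)) :=
          add_le_add le_rfl IH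
      _ = ENNReal.ofReal (ε ^ (Fintype.card d - 1) * lorentzLossRate v / ‖v‖ *
            (‖v‖ * t + 2 * (((u, ω) :: p).length + 1) * ε)) + volume (closedBall (0 : EuclideanSpace ℝ d) ε) := by
          have hν0 : 0 ≤ lorentzLossRate v := lorentzLossRate_nonneg v
          have hE : 0 ≤ ε ^ (Fintype.card d - 1) := by positivity
          have h1 : 0 ≤ ε ^ (Fintype.card d - 1) * lorentzLossRate v * (u * ‖v‖ + ε - -ε) / ‖v‖ :=
            div_nonneg (mul_nonneg (mul_nonneg hE hν0) (by nlinarith)) hvn.le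
          have h2 : 0 ≤ ε ^ (Fintype.card d - 1) * lorentzLossRate v₁ / ‖v₁‖ *
              (‖v₁‖ * (t - u) + 2 * (p.length + 1) * ε) := by
            rw [hv₁n, lorentzLossRate_reflect]
            have : 0 ≤ t - u := by linarith
            exact mul_nonneg (div_nonneg (mul_nonneg hE hν0) hvn.le) (by positivity)
          rw [← add_assoc, ← ENNReal.ofReal_add h1 h2]
          congr 2
          rw [hv₁n, lorentzLossRate_reflect]
          simp only [List.length_cons, Nat.cast_succ]
          field_simp
          ring

end

end Literature.MathematicalPhysics.KineticTheory
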